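import Literature.Analysis.FluidPDE.TaoCascadeZeroScaleEquipartition
import Literature.Analysis.FluidPDE.TaoCascadeFiveModes
import Literature.Analysis.FluidPDE.TaoCascadeRescaledEnergy
import HarnessLib

/-!
# Tao's cascade ODE, §6.7: ignition of `a₁` ((6.187)) and the fence `a₁ ≥ 0.05` ((6.188))

T. Tao, *Finite time blowup for an averaged three-dimensional Navier–Stokes equation*,
J. Amer. Math. Soc. **29** (2016), 601–674 = arXiv:1402.0290v3, §6.7: "We now claim that (6.187)
`a₁(t_c + 1/K) ≥ 0.1`. By (6.186) and Gronwall's inequality we will then have (6.188) `a₁(t) ≥ 0.05`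
for all `t_c + 1/K ≤ t ≤ τ₁` … Suppose that (6.187) fails. Then by (6.186) and Gronwall's
inequality we have `a₁(t) ≤ 0.1 + O(K⁻²⁰)` and `∫_{I'} K|d₀|²(t) dt ≤ 0.1 + O(K⁻²⁰)` where
`I' := [t_c + K⁻⁹, t_c + 1/K]` … `∫_{I'} a₀² - d₀² dt = O(K^{-100})` … `∫_{I'} ½(a₀² + d₀²) ≤ 0.1 +
O(K⁻¹)`. But from (6.146), (6.183), (6.166) … `½(a₀² + d₀²) ≥ 0.4` (say) … a contradiction."

Over `RescaledHypotheses γ …` (`TaoCascadeRescaled.lean`) with explicit levels: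

* `RescaledHypotheses.a_one_ignition` — the quoted contradiction argument in direct form: on
  `J = [u₀, u₁]` with `Ẽ₀, Ẽ₁ ≤ 1`, `Ẽ₋₁ ≤ E₋`, the Prop. 6.13 levels, `c_min ≤ c₀ ≤ c_max`
  (`c_min > 0`), `|b₀| ≤ b_max`, the sum-of-squares lower bound `Σ ≥ 1 - σ` ((6.146)) and
  `|a₁(u₀)| ≤ α₀`, if the explicit inequality `Φ₀ ≤ -α₀ - eℓ + κ(ℓ/2·(1 - σ - b_max² - c_max² -
  (Φ₀ + α₀ + eℓ)²) - Q/2)` holds (`ℓ = u₁ - u₀`, `κ = (1+ε₀)^{5/2}K`, `e = ν√2 + η₃`, `Q` the bound of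
  `abs_integral_sq_sub_sq_le`), then `a₁(u₁) ≥ Φ₀`;
* `RescaledHypotheses.a_one_fence` — (6.188): from `a₁(u₁) ≥ Φ₀` and the `a₁`-equation,
  `a₁(t) ≥ (Φ₀ - η₃e^{ν(T'-u₁)}(t - u₁))e^{-ν(t-u₁)}` on `[u₁, T']` (`lower_fence_of_abs_rate'`).

Theorems only.

## References

* T. Tao, J. Amer. Math. Soc. 29 (2016), 601–674, arXiv:1402.0290v3, §6.7 (6.186)–(6.190).
  [`Tao2016AveragedNS`]
-/

noncomputable section

open Set MeasureTheory intervalIntegral Filter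
open scoped _root_.Topology

namespace Literature.Analysis.FluidPDE

namespace TaoCascade

open Literature.Analysis.ODE

section Ignition

variable {γ ε₀ K ε C₁ C₂ C₃ : ℝ} {n₀ N : ℤ} {τ : ℤ → ℝ} {Xr : Fin 4 → ℤ → ℝ → ℝ} {Er : ℤ → ℝ → ℝ}

/-- **(6.186) integrated: `a₁` is almost nondecreasing.** On `[p, q]` (`0 ≤ p ≤ q`) with `Ẽ₁ ≤ 1`
and the Prop. 6.13 levels, `a₁(q) ≥ a₁(p) + κ∫ₚ^q d₀² - (ν√2 + η₃)(q - p)` (`κ = (1+ε₀)^{5/2}K`,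
`ν, η₃` the coefficients of `eq_a_one`). [cite: Tao2016AveragedNS, §6.7 (6.186)] -/
theorem RescaledHypotheses.a_one_sub_ge
    (h : RescaledHypotheses γ ε₀ K ε C₁ C₂ C₃ n₀ N τ Xr Er) (hε : 0 < ε) (hC₁ : 0 ≤ C₁)
    (hε₀ : 0 < ε₀) (hN : n₀ ≤ N) {p q Bb Bc Bd : ℝ} (hp : 0 ≤ p) (hpq : p ≤ q)
    (hreg : ∀ t ∈ Icc p q, Er 1 t ≤ 1)
    (hsec : ∀ t ∈ Icc p q, |Xr 1 1 t| ≤ Bb ∧ |Xr 2 1 t| ≤ Bc ∧ |Xr 3 1 t| ≤ Bd) :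
    Xr 0 1 p + ((1 + ε₀) ^ ((5 : ℝ) / 2) * K * ∫ s in p..q, Xr 3 0 s ^ 2) -
        ((1 + ε₀) ^ ((5 : ℝ) / 2) * (ε * Bb + ε ^ 2 * Real.exp (-K ^ 10) * Bc) * Real.sqrt 2 +
          ((1 + ε₀) ^ ((5 : ℝ) / 2) * (ε ^ 2)⁻¹ * Bc * Bd + C₁ * (1 + ε₀) ^ (2 - (n₀ : ℝ) / 2))) *
          (q - p) ≤ Xr 0 1 q := by
  have hτ0 : τ (n₀ - N) ≤ 0 := h.tau_init_le hN
  have hτp : τ (n₀ - N) ≤ p := hτ0.trans hp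
  have hq0 : (0 : ℝ) < 1 + ε₀ := by linarith
  set κ : ℝ := (1 + ε₀) ^ ((5 : ℝ) / 2) * K with hκ
  set ν : ℝ := (1 + ε₀) ^ ((5 : ℝ) / 2) * (ε * Bb + ε ^ 2 * Real.exp (-K ^ 10) * Bc) with hν
  set η₃ : ℝ := (1 + ε₀) ^ ((5 : ℝ) / 2) * (ε ^ 2)⁻¹ * Bc * Bd + C₁ * (1 + ε₀) ^ (2 - (n₀ : ℝ) / 2)
    with hη₃
  have hpm : p ∈ Icc p q := ⟨le_rfl, hpq⟩
  have hBb : 0 ≤ Bb := (abs_nonneg _).trans (hsec p hpm).1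
  have hBc : 0 ≤ Bc := (abs_nonneg _).trans (hsec p hpm).2.1
  have hν0 : 0 ≤ ν := by positivity
  have h1M : ∀ u ∈ Icc p q, |Xr 0 1 u| ≤ Real.sqrt 2 := fun u hu =>
    (h.abs_le_sqrt_energy 0 1 (hτp.trans hu.1)).trans (Real.sqrt_le_sqrt (by linarith [hreg u hu]))
  have hcd : ContinuousOn (fun s => κ * Xr 3 0 s ^ 2 - (ν * Real.sqrt 2 + η₃)) (Icc p q) :=
    (continuousOn_const.mul ((h.continuousOn_X 3 0 hτp).pow 2)).sub continuousOn_const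
  have key := add_integral_le_of_le_deriv_right (h.continuousOn_X 0 1 hτp)
    (fun s hs => h.hasDeriv_X 0 1 (hτp.trans hs.1)) hcd (fun s hs => ?_) ⟨hpq, le_rfl⟩
  · have hint1 : IntervalIntegrable (fun s => κ * Xr 3 0 s ^ 2) volume p q :=
      ((continuousOn_const.mul ((h.continuousOn_X 3 0 hτp).pow 2)).mono
        (by rw [uIcc_of_le hpq])).intervalIntegrable
    have hint2 : IntervalIntegrable (fun _ : ℝ => ν * Real.sqrt 2 + η₃) volume p q :=
      intervalIntegrable_const
    rw [intervalIntegral.integral_sub hint1 hint2, intervalIntegral.integral_const_mul,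
      intervalIntegral.integral_const, smul_eq_mul] at key
    linarith [key]
  · have hs' : s ∈ Icc p q := Ico_subset_Icc_self hs
    have hsecs := hsec s hs'
    have he := (abs_le.mp (h.eq_a_one hε hC₁ (by linarith) (hτp.trans hs.1) (hreg s hs') hsecs.1
      hsecs.2.1 hsecs.2.2)).1
    have hνa : ν * |Xr 0 1 s| ≤ ν * Real.sqrt 2 := mul_le_mul_of_nonneg_left (h1M s hs') hν0
    show κ * Xr 3 0 s ^ 2 - (ν * Real.sqrt 2 + η₃) ≤ derivWithin (Xr 0 1) (Ici (τ (n₀ - N))) s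
    linarith [he, hνa]

/-- **(6.187): ignition of `a₁` across a fast-rotor interval.** On `J = [u₀, u₁]` (`0 ≤ u₀ ≤ u₁`,
`ℓ = u₁ - u₀`) assume `Ẽ₀, Ẽ₁ ≤ 1`, `Ẽ₋₁ ≤ E₋`, `|b₁| ≤ B_b`, `|c₁| ≤ B_c`, `|d₁| ≤ B_d`,
`0 < c_min ≤ c₀ ≤ c_max`, `|b₀| ≤ b_max`, (6.146) `a₀² + b₀² + c₀² + d₀² + a₁² ≥ 1 - σ`, and
`|a₁(u₀)| ≤ α₀`. With `ρ = ε⁻²`, `κ = (1+ε₀)^{5/2}K`, `M = √2`, `η = C₁(1+ε₀)^{-n₀/2}`,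
`η₁ = 2ε + 2ε²e^{-K^{10}} + 2KE₋ + η`, `ν, η₃` as in `eq_a_one`, `e = νM + η₃`,
`L = ε⁻¹K^{10}b_max + (ε²e^{-K^{10}}M² + η)/c_min`, `Q = (2M² + (M²L + κM³ + (η₁ + η)M)ℓ)/(ρc_min)`:
if `0 ≤ Φ₀ ≤ -α₀ - eℓ + κ(ℓ/2·(1 - σ - b_max² - c_max² - (Φ₀ + α₀ + eℓ)²) - Q/2)` then `a₁(u₁) ≥ Φ₀`.
[cite: Tao2016AveragedNS, §6.7 (6.187), (6.189)–(6.190)] -/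
theorem RescaledHypotheses.a_one_ignition
    (h : RescaledHypotheses γ ε₀ K ε C₁ C₂ C₃ n₀ N τ Xr Er) (hε : 0 < ε) (hK : 0 < K) (hC₁ : 0 ≤ C₁)
    (hε₀ : 0 < ε₀) (hN : n₀ ≤ N) {u₀ u₁ Em Bb Bc Bd cmin cmax bmax σ α₀ Φ₀ : ℝ} (hu₀ : 0 ≤ u₀)
    (hu : u₀ ≤ u₁) (hcmin : 0 < cmin) (hΦ₀ : 0 ≤ Φ₀)
    (hreg : ∀ t ∈ Icc u₀ u₁, Er 0 t ≤ 1 ∧ Er 1 t ≤ 1 ∧ Er (-1) t ≤ Em)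
    (hsec : ∀ t ∈ Icc u₀ u₁, |Xr 1 1 t| ≤ Bb ∧ |Xr 2 1 t| ≤ Bc ∧ |Xr 3 1 t| ≤ Bd)
    (hc : ∀ t ∈ Icc u₀ u₁, cmin ≤ Xr 2 0 t ∧ Xr 2 0 t ≤ cmax) (hb : ∀ t ∈ Icc u₀ u₁, |Xr 1 0 t| ≤ bmax)
    (hS : ∀ t ∈ Icc u₀ u₁,
      1 - σ ≤ Xr 0 0 t ^ 2 + Xr 1 0 t ^ 2 + Xr 2 0 t ^ 2 + Xr 3 0 t ^ 2 + Xr 0 1 t ^ 2)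
    (hα₀ : |Xr 0 1 u₀| ≤ α₀) :
    let ρ : ℝ := (ε ^ 2)⁻¹
    let κ : ℝ := (1 + ε₀) ^ ((5 : ℝ) / 2) * K
    let M : ℝ := Real.sqrt 2
    let η : ℝ := C₁ * (1 + ε₀) ^ (-((n₀ : ℝ) / 2))
    let η₁ : ℝ := 2 * ε + 2 * ε ^ 2 * Real.exp (-K ^ 10) + 2 * K * Em + η
    let ν : ℝ := (1 + ε₀) ^ ((5 : ℝ) / 2) * (ε * Bb + ε ^ 2 * Real.exp (-K ^ 10) * Bc)
    let η₃ : ℝ := (1 + ε₀) ^ ((5 : ℝ) / 2) * (ε ^ 2)⁻¹ * Bc * Bd + C₁ * (1 + ε₀) ^ (2 - (n₀ : ℝ) / 2)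
    let e : ℝ := ν * M + η₃
    let L : ℝ := ε⁻¹ * K ^ 10 * bmax + (ε ^ 2 * Real.exp (-K ^ 10) * M ^ 2 + η) / cmin
    let Q : ℝ := (2 * M ^ 2 + (M ^ 2 * L + |κ| * M ^ 3 + (η₁ + η) * M) * (u₁ - u₀)) / (ρ * cmin)
    Φ₀ ≤ -α₀ - e * (u₁ - u₀) + κ * ((u₁ - u₀) / 2 *
      (1 - σ - bmax ^ 2 - cmax ^ 2 - (Φ₀ + α₀ + e * (u₁ - u₀)) ^ 2) - Q / 2) →
    Φ₀ ≤ Xr 0 1 u₁ := by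
  intro ρ κ M η η₁ ν η₃ e L Q hbig
  have hρ_def : ρ = (ε ^ 2)⁻¹ := rfl
  have hκ_def : κ = (1 + ε₀) ^ ((5 : ℝ) / 2) * K := rfl
  have hM_def : M = Real.sqrt 2 := rfl
  have hη_def : η = C₁ * (1 + ε₀) ^ (-((n₀ : ℝ) / 2)) := rfl
  have hη₁_def : η₁ = 2 * ε + 2 * ε ^ 2 * Real.exp (-K ^ 10) + 2 * K * Em + η := rfl
  have hν_def : ν = (1 + ε₀) ^ ((5 : ℝ) / 2) * (ε * Bb + ε ^ 2 * Real.exp (-K ^ 10) * Bc) := rfl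
  have hη₃_def : η₃ = (1 + ε₀) ^ ((5 : ℝ) / 2) * (ε ^ 2)⁻¹ * Bc * Bd +
      C₁ * (1 + ε₀) ^ (2 - (n₀ : ℝ) / 2) := rfl
  have he_def : e = ν * M + η₃ := rfl
  have hL_def : L = ε⁻¹ * K ^ 10 * bmax + (ε ^ 2 * Real.exp (-K ^ 10) * M ^ 2 + η) / cmin := rfl
  have hQ_def : Q = (2 * M ^ 2 + (M ^ 2 * L + |κ| * M ^ 3 + (η₁ + η) * M) * (u₁ - u₀)) / (ρ * cmin) :=
    rfl
  have hτ0 : τ (n₀ - N) ≤ 0 := h.tau_init_le hN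
  have hτu : τ (n₀ - N) ≤ u₀ := hτ0.trans hu₀
  have hq0 : (0 : ℝ) < 1 + ε₀ := by linarith
  have hu₀m : u₀ ∈ Icc u₀ u₁ := ⟨le_rfl, hu⟩
  have hEm : 0 ≤ Em := (h.nonneg_F (-1) u₀ hτu).trans (hreg u₀ hu₀m).2.2
  have hBb : 0 ≤ Bb := (abs_nonneg _).trans (hsec u₀ hu₀m).1
  have hBc : 0 ≤ Bc := (abs_nonneg _).trans (hsec u₀ hu₀m).2.1
  have hBd : 0 ≤ Bd := (abs_nonneg _).trans (hsec u₀ hu₀m).2.2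
  have hbmax : 0 ≤ bmax := (abs_nonneg _).trans (hb u₀ hu₀m)
  have hρ : 0 < ρ := by rw [hρ_def]; positivity
  have hκ : 0 < κ := by rw [hκ_def]; positivity
  have hM : 0 < M := by rw [hM_def]; positivity
  have hM2 : M ^ 2 = 2 := by rw [hM_def]; exact Real.sq_sqrt (by norm_num)
  have hη : 0 ≤ η := by rw [hη_def]; positivity
  have hν : 0 ≤ ν := by rw [hν_def]; positivity
  have hη₃ : 0 ≤ η₃ := by rw [hη₃_def]; positivity
  have he : 0 ≤ e := by rw [he_def]; positivity
  clear_value ρ κ M η η₁ ν η₃ e L Q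
  set ℓ : ℝ := u₁ - u₀ with hℓ
  have hℓ0 : 0 ≤ ℓ := by rw [hℓ]; linarith
  have hCpos : ∀ u ∈ Icc u₀ u₁, 0 < Xr 2 0 u := fun u hu => hcmin.trans_le (hc u hu).1
  -- size of the modes
  have haM : ∀ u ∈ Icc u₀ u₁, |Xr 0 0 u| ≤ M := fun u hu => by
    rw [hM_def]
    exact (h.abs_le_sqrt_energy 0 0 (hτu.trans hu.1)).trans
      (Real.sqrt_le_sqrt (by linarith [(hreg u hu).1]))
  have hdM : ∀ u ∈ Icc u₀ u₁, |Xr 3 0 u| ≤ M := fun u hu => by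
    rw [hM_def]
    exact (h.abs_le_sqrt_energy 3 0 (hτu.trans hu.1)).trans
      (Real.sqrt_le_sqrt (by linarith [(hreg u hu).1]))
  have h1M : ∀ u ∈ Icc u₀ u₁, |Xr 0 1 u| ≤ M := fun u hu => by
    rw [hM_def]
    exact (h.abs_le_sqrt_energy 0 1 (hτu.trans hu.1)).trans
      (Real.sqrt_le_sqrt (by linarith [(hreg u hu).2.1]))
  -- (6.186) integrated, on `[u₀, t]` and on `[t, u₁]`
  have hreg1 : ∀ t ∈ Icc u₀ u₁, Er 1 t ≤ 1 := fun t ht => (hreg t ht).2.1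
  have hmono : ∀ p q, u₀ ≤ p → p ≤ q → q ≤ u₁ →
      Xr 0 1 p + κ * (∫ s in p..q, Xr 3 0 s ^ 2) - e * (q - p) ≤ Xr 0 1 q := by
    intro p q hp hpq hq
    have hsub : Icc p q ⊆ Icc u₀ u₁ := Icc_subset_Icc hp hq
    have := h.a_one_sub_ge hε hC₁ hε₀ hN (hu₀.trans hp) hpq (fun t ht => hreg1 t (hsub ht))
      (fun t ht => hsec t (hsub ht))
    rw [he_def, hν_def, hη₃_def, hκ_def, hM_def]
    exact this
  have hint_nonneg : ∀ p q, p ≤ q → 0 ≤ ∫ s in p..q, Xr 3 0 s ^ 2 := fun p q hpq =>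
    intervalIntegral.integral_nonneg hpq fun s _ => sq_nonneg _
  -- the equipartition bound `|∫_J (a₀² - d₀²)| ≤ Q`
  have hQ : |∫ s in u₀..u₁, (Xr 0 0 s ^ 2 - Xr 3 0 s ^ 2)| ≤ Q := by
    have hcL : ∀ u ∈ Icc u₀ u₁, |derivWithin (Xr 2 0) (Ici (τ (n₀ - N))) u| ≤ L * Xr 2 0 u := by
      intro u hu
      have hCu := hCpos u hu
      have hec := h.eq_c_zero hC₁ (by linarith) (hτu.trans hu.1) (hreg u hu).1
      have hbu := hb u hu
      have hau := haM u hu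
      have hsrc : ε ^ 2 * Real.exp (-K ^ 10) * Xr 0 0 u ^ 2 ≤ ε ^ 2 * Real.exp (-K ^ 10) * M ^ 2 := by
        refine mul_le_mul_of_nonneg_left ?_ (by positivity)
        rw [← sq_abs]; exact pow_le_pow_left₀ (abs_nonneg _) hau 2
      have hrot : |ε⁻¹ * K ^ 10 * Xr 1 0 u * Xr 2 0 u| ≤ ε⁻¹ * K ^ 10 * bmax * Xr 2 0 u := by
        rw [abs_mul, abs_mul, abs_of_pos hCu, abs_of_nonneg (by positivity : (0 : ℝ) ≤ ε⁻¹ * K ^ 10)]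
        exact mul_le_mul_of_nonneg_right (mul_le_mul_of_nonneg_left hbu (by positivity)) hCu.le
      have htri : |derivWithin (Xr 2 0) (Ici (τ (n₀ - N))) u| ≤
          η + ε ^ 2 * Real.exp (-K ^ 10) * Xr 0 0 u ^ 2 + |ε⁻¹ * K ^ 10 * Xr 1 0 u * Xr 2 0 u| := by
        have h1 := abs_le.mp hec
        have h2 := le_abs_self (ε⁻¹ * K ^ 10 * Xr 1 0 u * Xr 2 0 u)
        have h3 := neg_abs_le (ε⁻¹ * K ^ 10 * Xr 1 0 u * Xr 2 0 u)
        have h4 : 0 ≤ ε ^ 2 * Real.exp (-K ^ 10) * Xr 0 0 u ^ 2 := by positivity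
        rw [hη_def]
        rw [abs_le]; constructor <;> linarith only [h1.1, h1.2, h2, h3, h4]
      have hconst : η + ε ^ 2 * Real.exp (-K ^ 10) * M ^ 2 ≤
          (ε ^ 2 * Real.exp (-K ^ 10) * M ^ 2 + η) / cmin * Xr 2 0 u := by
        rw [div_mul_eq_mul_div, le_div_iff₀ hcmin]
        have := mul_le_mul_of_nonneg_left (hc u hu).1
          (show 0 ≤ ε ^ 2 * Real.exp (-K ^ 10) * M ^ 2 + η by positivity)
        linarith only [this]
      rw [hL_def]
      have : (ε⁻¹ * K ^ 10 * bmax + (ε ^ 2 * Real.exp (-K ^ 10) * M ^ 2 + η) / cmin) * Xr 2 0 u =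
          ε⁻¹ * K ^ 10 * bmax * Xr 2 0 u + (ε ^ 2 * Real.exp (-K ^ 10) * M ^ 2 + η) / cmin * Xr 2 0 u := by
        ring
      rw [this]
      linarith only [htri, hsrc, hrot, hconst]
    have hA : ∀ u ∈ Icc u₀ u₁,
        |derivWithin (Xr 0 0) (Ici (τ (n₀ - N))) u + ρ * Xr 2 0 u * Xr 3 0 u| ≤ η₁ := by
      intro u hu
      rw [hη₁_def, hη_def, hρ_def]
      exact h.eq_a_zero hε.le hK.le hC₁ (by linarith) (hτu.trans hu.1) (hreg u hu).1 (hreg u hu).2.2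
    have hD : ∀ u ∈ Icc u₀ u₁, |derivWithin (Xr 3 0) (Ici (τ (n₀ - N))) u -
        (ρ * Xr 2 0 u * Xr 0 0 u - κ * Xr 3 0 u * Xr 0 1 u)| ≤ η := by
      intro u hu
      rw [hη_def, hρ_def, hκ_def]
      exact h.eq_d_zero hC₁ (by linarith) (hτu.trans hu.1) (hreg u hu).1
    have key := abs_integral_sq_sub_sq_le (ρ := ρ) (κ := κ) (η₁ := η₁) (η₂ := η) (L := L) (M := M)
      (c_min := cmin) (a₁ := Xr 0 1) (h.contDiffOn_Y 0 0) (h.contDiffOn_Y 3 0) (h.contDiffOn_Y 2 0)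
      hτu hu hρ hcmin (fun u hu => (hc u hu).1) hcL haM hdM h1M hA hD
    rw [hQ_def]
    exact key
  -- suppose `a₁(u₁) < Φ₀` and derive a contradiction
  by_contra hcon
  push Not at hcon
  -- upper and lower bounds for `a₁` on `J`
  have hup : ∀ t ∈ Icc u₀ u₁, Xr 0 1 t ≤ Φ₀ + e * ℓ := by
    intro t ht
    have h1 := hmono t u₁ ht.1 ht.2 le_rfl
    have h2 := hint_nonneg t u₁ ht.2
    have h3 : e * (u₁ - t) ≤ e * ℓ := mul_le_mul_of_nonneg_left (by rw [hℓ]; linarith [ht.1]) he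
    have hκI : 0 ≤ κ * ∫ s in t..u₁, Xr 3 0 s ^ 2 := mul_nonneg hκ.le h2
    linarith only [h1, hκI, h3, hcon]
  have hlo : ∀ t ∈ Icc u₀ u₁, -(α₀ + e * ℓ) ≤ Xr 0 1 t := by
    intro t ht
    have h1 := hmono u₀ t le_rfl ht.1 ht.2
    have h2 := hint_nonneg u₀ t ht.1
    have h3 : e * (t - u₀) ≤ e * ℓ := mul_le_mul_of_nonneg_left (by rw [hℓ]; linarith [ht.2]) he
    have h4 := (abs_le.mp hα₀).1
    have hκI : 0 ≤ κ * ∫ s in u₀..t, Xr 3 0 s ^ 2 := mul_nonneg hκ.le h2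
    linarith only [h1, hκI, h3, h4]
  have hsq1 : ∀ t ∈ Icc u₀ u₁, Xr 0 1 t ^ 2 ≤ (Φ₀ + α₀ + e * ℓ) ^ 2 := by
    intro t ht
    have hα : 0 ≤ α₀ := (abs_nonneg _).trans hα₀
    have h1 := hup t ht
    have h2 := hlo t ht
    have heℓ : 0 ≤ e * ℓ := mul_nonneg he hℓ0
    have habs : |Xr 0 1 t| ≤ Φ₀ + α₀ + e * ℓ := by
      rw [abs_le]; constructor <;> linarith only [h1, h2, hα, hΦ₀, heℓ]
    rw [← sq_abs]
    exact pow_le_pow_left₀ (abs_nonneg _) habs 2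
  -- pointwise lower bound for `a₀² + d₀²` on `J`
  have hpt : ∀ t ∈ Icc u₀ u₁,
      1 - σ - bmax ^ 2 - cmax ^ 2 - (Φ₀ + α₀ + e * ℓ) ^ 2 ≤ Xr 0 0 t ^ 2 + Xr 3 0 t ^ 2 := by
    intro t ht
    have h1 := hS t ht
    have h2 : Xr 1 0 t ^ 2 ≤ bmax ^ 2 := by
      rw [← sq_abs]; exact pow_le_pow_left₀ (abs_nonneg _) (hb t ht) 2
    have h3 : Xr 2 0 t ^ 2 ≤ cmax ^ 2 := pow_le_pow_left₀ (hCpos t ht).le (hc t ht).2 2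
    have h4 := hsq1 t ht
    linarith
  -- integrate
  have hca := h.continuousOn_X 0 0 hτu (b := u₁)
  have hcd := h.continuousOn_X 3 0 hτu (b := u₁)
  have hint_ad : IntervalIntegrable (fun s => Xr 0 0 s ^ 2 + Xr 3 0 s ^ 2) volume u₀ u₁ :=
    (((hca.pow 2).add (hcd.pow 2)).mono (by rw [uIcc_of_le hu])).intervalIntegrable
  have hint_a : IntervalIntegrable (fun s => Xr 0 0 s ^ 2) volume u₀ u₁ :=
    ((hca.pow 2).mono (by rw [uIcc_of_le hu])).intervalIntegrable
  have hint_d : IntervalIntegrable (fun s => Xr 3 0 s ^ 2) volume u₀ u₁ :=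
    ((hcd.pow 2).mono (by rw [uIcc_of_le hu])).intervalIntegrable
  have hI1 : (1 - σ - bmax ^ 2 - cmax ^ 2 - (Φ₀ + α₀ + e * ℓ) ^ 2) * ℓ ≤
      ∫ s in u₀..u₁, (Xr 0 0 s ^ 2 + Xr 3 0 s ^ 2) := by
    have := intervalIntegral.integral_mono_on hu intervalIntegrable_const hint_ad hpt
    rw [intervalIntegral.integral_const, smul_eq_mul] at this
    rw [hℓ]; linarith [this]
  have hsplit : ∫ s in u₀..u₁, (Xr 0 0 s ^ 2 + Xr 3 0 s ^ 2) =
      (∫ s in u₀..u₁, Xr 0 0 s ^ 2) + ∫ s in u₀..u₁, Xr 3 0 s ^ 2 :=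
    intervalIntegral.integral_add hint_a hint_d
  have hsplit' : ∫ s in u₀..u₁, (Xr 0 0 s ^ 2 - Xr 3 0 s ^ 2) =
      (∫ s in u₀..u₁, Xr 0 0 s ^ 2) - ∫ s in u₀..u₁, Xr 3 0 s ^ 2 :=
    intervalIntegral.integral_sub hint_a hint_d
  have hQ' := (abs_le.mp hQ).2
  rw [hsplit'] at hQ'
  -- `∫_J d₀² ≥ ½∫(a₀² + d₀²) - Q/2`
  have hId : (1 - σ - bmax ^ 2 - cmax ^ 2 - (Φ₀ + α₀ + e * ℓ) ^ 2) * ℓ / 2 - Q / 2 ≤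
      ∫ s in u₀..u₁, Xr 3 0 s ^ 2 := by
    rw [hsplit] at hI1
    linarith
  -- (6.186) on all of `J`
  have hfin := hmono u₀ u₁ le_rfl hu le_rfl
  have h4 := (abs_le.mp hα₀).1
  have hκI : κ * ((1 - σ - bmax ^ 2 - cmax ^ 2 - (Φ₀ + α₀ + e * ℓ) ^ 2) * ℓ / 2 - Q / 2) ≤
      κ * ∫ s in u₀..u₁, Xr 3 0 s ^ 2 := mul_le_mul_of_nonneg_left hId hκ.le
  have : Φ₀ ≤ Xr 0 1 u₁ := by
    have e1 : κ * ((u₁ - u₀) / 2 * (1 - σ - bmax ^ 2 - cmax ^ 2 - (Φ₀ + α₀ + e * (u₁ - u₀)) ^ 2) - Q / 2) =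
        κ * ((1 - σ - bmax ^ 2 - cmax ^ 2 - (Φ₀ + α₀ + e * ℓ) ^ 2) * ℓ / 2 - Q / 2) := by
      rw [hℓ]; ring
    rw [e1] at hbig
    linarith [hbig, hκI, hfin]
  linarith

/-- **(6.188): the fence `a₁ ≥ 0.05`.** On `[u₁, T']` (`0 ≤ u₁ ≤ T'`) with `Ẽ₁ ≤ 1`, the Prop. 6.13
levels, `a₁(u₁) ≥ Φ₀` and `η₃e^{ν(T'-u₁)}(T' - u₁) < Φ₀` (`ν, η₃` the coefficients of `eq_a_one`):
`a₁(t) ≥ (Φ₀ - η₃e^{ν(T'-u₁)}(t - u₁))e^{-ν(t-u₁)}` for `t ∈ [u₁, T']`.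
[cite: Tao2016AveragedNS, §6.7 (6.186), (6.188)] -/
theorem RescaledHypotheses.a_one_fence
    (h : RescaledHypotheses γ ε₀ K ε C₁ C₂ C₃ n₀ N τ Xr Er) (hε : 0 < ε) (hK : 0 < K) (hC₁ : 0 ≤ C₁)
    (hε₀ : 0 < ε₀) (hN : n₀ ≤ N) {u₁ T' Bb Bc Bd Φ₀ : ℝ} (hu₁ : 0 ≤ u₁) (huT : u₁ ≤ T')
    (hreg : ∀ t ∈ Icc u₁ T', Er 1 t ≤ 1)
    (hsec : ∀ t ∈ Icc u₁ T', |Xr 1 1 t| ≤ Bb ∧ |Xr 2 1 t| ≤ Bc ∧ |Xr 3 1 t| ≤ Bd)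
    (hΦ : Φ₀ ≤ Xr 0 1 u₁)
    (hsmall : ((1 + ε₀) ^ ((5 : ℝ) / 2) * (ε ^ 2)⁻¹ * Bc * Bd + C₁ * (1 + ε₀) ^ (2 - (n₀ : ℝ) / 2)) *
        Real.exp ((1 + ε₀) ^ ((5 : ℝ) / 2) * (ε * Bb + ε ^ 2 * Real.exp (-K ^ 10) * Bc) * (T' - u₁)) *
        (T' - u₁) < Φ₀)
    {t : ℝ} (ht : t ∈ Icc u₁ T') :
    (Φ₀ - ((1 + ε₀) ^ ((5 : ℝ) / 2) * (ε ^ 2)⁻¹ * Bc * Bd + C₁ * (1 + ε₀) ^ (2 - (n₀ : ℝ) / 2)) *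
        Real.exp ((1 + ε₀) ^ ((5 : ℝ) / 2) * (ε * Bb + ε ^ 2 * Real.exp (-K ^ 10) * Bc) * (T' - u₁)) *
        (t - u₁)) *
      Real.exp (-((1 + ε₀) ^ ((5 : ℝ) / 2) * (ε * Bb + ε ^ 2 * Real.exp (-K ^ 10) * Bc)) * (t - u₁)) ≤
      Xr 0 1 t := by
  have hτ0 : τ (n₀ - N) ≤ 0 := h.tau_init_le hN
  have hτu : τ (n₀ - N) ≤ u₁ := hτ0.trans hu₁
  have hq0 : (0 : ℝ) < 1 + ε₀ := by linarith
  have hu₁m : u₁ ∈ Icc u₁ T' := ⟨le_rfl, huT⟩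
  have hBb : 0 ≤ Bb := (abs_nonneg _).trans (hsec u₁ hu₁m).1
  have hBc : 0 ≤ Bc := (abs_nonneg _).trans (hsec u₁ hu₁m).2.1
  have hBd : 0 ≤ Bd := (abs_nonneg _).trans (hsec u₁ hu₁m).2.2
  refine lower_fence_of_abs_rate' (h.continuousOn_X 0 1 hτu) (fun s hs => h.hasDeriv_X 0 1 (hτu.trans hs.1))
    (by positivity) (by positivity) (fun s hs => ?_) hΦ hsmall ht
  have hs' : s ∈ Icc u₁ T' := Ico_subset_Icc_self hs
  have hsecs := hsec s hs'
  have he := (abs_le.mp (h.eq_a_one hε hC₁ (by linarith) (hτu.trans hs.1) (hreg s hs') hsecs.1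
    hsecs.2.1 hsecs.2.2)).1
  have hpos : 0 ≤ (1 + ε₀) ^ ((5 : ℝ) / 2) * K * Xr 3 0 s ^ 2 := by positivity
  linarith [he, hpos]

end Ignition

end TaoCascade

end Literature.Analysis.FluidPDE
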